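import Literature.MathematicalPhysics.KineticTheory.TaggedLinearBoltzmannSeries
import Literature.Analysis.FluidPDE.SphereMeasureSymmetry
import HarnessLib

/-!
# The tagged Boltzmann hierarchy: `g_α^{(s)} = φ_α ⊗ M_β^{⊗s}` is a solution (BGSR Remark 3.4)
(Bodineau–Gallagher–Saint-Raymond, Invent. Math. 203 (2016) = arXiv:1305.3397v2, §3.3; trunk
T-KINETIC, topic MathematicalPhysics/KineticTheory; a layer of the bottom-up proof plan of the
named fact `Hilbert6.bgsr_theorem22` recorded in `TaggedSphereLinearBoltzmann`)

BGSR §3.3 (p. 10): the Boltzmann hierarchy of the tagged-sphere problem is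
`(∂ₜ + ∑ᵢ vᵢ·∇_{xᵢ}) g^{(s)} = α C⁰_{s,s+1} g^{(s+1)}` with the collision operator (3.7)
`(C⁰_{s,s+1} g^{(s+1)})(Z_s) = ∑_{i ≤ s} ∫ [g^{(s+1)}(…, xᵢ, vᵢ*, …, xᵢ, v*_{s+1}) ((v_{s+1} - vᵢ)·ν)₊
  - g^{(s+1)}(…, xᵢ, vᵢ, …, xᵢ, v_{s+1}) ((v_{s+1} - vᵢ)·ν)₋] dν dv_{s+1}`,
and Remark 3.4 states that `g_α^{(s)}(t, Z_s) := φ_α(t, z₁) M_β^{⊗s}(V_s)` "is a solution to the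
Boltzmann hierarchy with initial data `g^{0(s)}` since `φ_α` satisfies the linear Boltzmann
equation (1.3) with initial data `ρ⁰`". This file PROVES that statement, in mild form, for the
collision-series solution `φ_α` of (1.3) constructed in `TaggedLinearBoltzmannSeries` (the unique
solution in the bounded continuous class), on any position geometry with continuous translations,
with the accepted hierarchy objects of `Literature.Analysis.FluidPDE.BBGKYMarginals`
(`Kinetic.freeTransport`, `Kinetic.boltzmannHOp` = `C⁰_{s,s+1}` of GST 2013 (4.4.5),
`Kinetic.IsMildBoltzmannHierarchySolutionOn`).

## What is proved

* `maxwellianTensor_gainConfig`, `maxwellianTensor_lossConfig` — detailed balance in the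
  collision configurations: at `ε = 0` the Maxwellian tensor takes the same value
  `M^{⊗s}(Z_s) M(v)` on the gain and loss configurations of every collision term.
* `hsCollisionTerm_bgsrHierarchyFamily_of_ne` — **background collisions do not contribute**:
  for `i ≠ 0` the `i`-th collision term of `φ ⊗ M^{⊗(k+2)}` vanishes (gain and loss integrands
  agree up to the kernel, and `∫∫ (ω·(v - vᵢ)) C(v) dv dω = 0` by the antipodal symmetry of the
  sphere, `Hilbert6.integral_comp_neg_sphere`).
* `hsCollisionTerm_bgsrHierarchyFamily_zero`, `boltzmannHOp_bgsrHierarchyFamily` — **the tagged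
  particle's collision term is the linear Boltzmann operator**:
  `C⁰_{k+1,k+2}(φ ⊗ M^{⊗(k+2)})(W) = M^{⊗(k+1)}(W) [K⁺_β φ(τ, x₀, ·)(v₀) - a_β(v₀) φ(τ, x₀, v₀)]`,
  `(x₀, v₀) = W 0` (the antipodal change of variables converts the pre-collisional
  parametrisation `(ω·(v - v₀))_±`, `ω` outside, of `Kinetic.hsCollisionTerm` into the kernel
  `((v₀ - v)·ν)₊`, `ν` inside, of (1.3); Fubini; evenness of the loss frequency).
* `LinearBoltzmannData.bgsrHierarchyFamily_duhamel` — **Remark 3.4 with the rate `α` of (3.7)**: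
  for `s = k + 1 ≥ 1`, `t ≥ 0`,
  `g^{(s)}(t) = S_s(t) g^{(s)}(0) + α ∫₀ᵗ S_s(t - τ) C⁰_{s,s+1} g^{(s+1)}(τ) dτ` pointwise, from
  the Duhamel form of (1.3) along characteristics
  (`LinearBoltzmannData.linearBoltzmannSeries_duhamel`).
* `LinearBoltzmannData.isMildBoltzmannHierarchySolutionOn` — the rescaled family
  `(α^s g_α^{(s)})_s` (with the constant `1` at the empty level `s = 0`) is an
  `IsMildBoltzmannHierarchySolutionOn` in the accepted rate-free sense (the factor `α` is absorbed
  by linearity), on every `[0, T]`; `isMildBoltzmannHierarchySolutionOn_torus` specialises to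
  BGSR's setting (`T^d`, datum `ρ⁰(x)`).

## Design choices

* The tagged particle is particle `0` (BGSR label it `1`); `bgsrHierarchyFamily β φ (k+1) t Z =
  φ t (Z 0) · M_β^{⊗(k+1)}(Z)`, and the value at `s = 0` (no particle, never used by the levels
  `s ≥ 1`) is the constant `1`, which trivially satisfies the empty level of the hierarchy.
* BGSR's hierarchy carries the rate `α` in front of `C⁰`; the accepted predicate does not, whence
  the two forms (explicit-`α` identity, and the rescaled family in the accepted predicate).
* Hypotheses are those of `LinearBoltzmannData` (`β > 0`, `α ≥ 0`, continuous translations,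
  continuous datum `0 ≤ f₀ ≤ R`); positions live on a locally compact first countable space.

## References

* T. Bodineau, I. Gallagher, L. Saint-Raymond, *The Brownian motion as the limit of a
  deterministic system of hard-spheres*, Invent. Math. 203 (2016) 493–553 = arXiv:1305.3397v2,
  §3.3: (3.7), (3.8), Remark 3.4 (p. 10).
* I. Gallagher, L. Saint-Raymond, B. Texier, *From Newton to Boltzmann* (2013), (4.3.6),
  (4.4.5)–(4.4.7) (the hierarchy operators as vendored in `BBGKYMarginals`).
-/

open MeasureTheory Metric Real Set Filter Topology
open scoped InnerProductSpace ENNReal Interval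

namespace Literature.MathematicalPhysics.KineticTheory

noncomputable section

section Hilbert6

variable {d : Type*} [Fintype d]

local notation "𝔼" => EuclideanSpace ℝ d
local notation "𝕊" => sphere (0 : EuclideanSpace ℝ d) 1

/-! ## BGSR Remark 3.4: `g_α^{(s)} = φ_α ⊗ M_β^{⊗ s}` solves the tagged Boltzmann hierarchy -/

section Hierarchy

variable {X : Type*} {s : ℕ}

/-- The Maxwellian tensor factor `M_β^{⊗s}(V_s)`. [folklore] -/
abbrev maxwellianTensor (β : ℝ) (s : ℕ) (Z : Literature.Analysis.FluidPDE.Config s d X) : ℝ :=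
  Literature.Analysis.FluidPDE.tensorPow s (fun p : X × 𝔼 => Literature.Analysis.FunctionSpaces.maxwellianBeta β p.2) Z

/-- `M^{⊗(s+1)}(Z_s, (x, v)) = M^{⊗s}(Z_s) M(v)`. [folklore] -/
theorem maxwellianTensor_appendParticle (β : ℝ) (Zs : Literature.Analysis.FluidPDE.Config s d X) (x : X) (v : 𝔼) :
    maxwellianTensor β (s + 1) (Literature.Analysis.FluidPDE.appendParticle Zs x v) =
      maxwellianTensor β s Zs * Literature.Analysis.FunctionSpaces.maxwellianBeta β v := by
  simp only [maxwellianTensor, Literature.Analysis.FluidPDE.appendParticle]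
  rw [Literature.Analysis.FluidPDE.tensorPow_append]
  simp [Literature.Analysis.FluidPDE.tensorPow]

/-- The Maxwellian tensor only sees velocities: it is invariant under free flight. [folklore] -/
theorem maxwellianTensor_freeFlight (G : Literature.Analysis.FluidPDE.Geometry d X) (β t : ℝ) (Z : Literature.Analysis.FluidPDE.Config s d X) :
    maxwellianTensor β s (Literature.Analysis.FluidPDE.freeFlight G t Z) = maxwellianTensor β s Z := by
  simp [maxwellianTensor, Literature.Analysis.FluidPDE.tensorPow]

/-- Splitting off the `i`-th factor of the Maxwellian tensor. [folklore] -/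
theorem maxwellianTensor_eq_mul_prod [DecidableEq (Fin s)] (β : ℝ) (Zs : Literature.Analysis.FluidPDE.Config s d X)
    (i : Fin s) : maxwellianTensor β s Zs = Literature.Analysis.FunctionSpaces.maxwellianBeta β (Zs i).2 *
      ∏ j ∈ Finset.univ \ {i}, Literature.Analysis.FunctionSpaces.maxwellianBeta β (Zs j).2 := by
  simp only [maxwellianTensor, Literature.Analysis.FluidPDE.tensorPow]
  exact Finset.prod_eq_mul_prod_sdiff_singleton_of_mem (Finset.mem_univ i) _

/-- The Maxwellian tensor of a configuration with the `i`-th particle updated. [folklore] -/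
theorem maxwellianTensor_update [DecidableEq (Fin s)] (β : ℝ) (Zs : Literature.Analysis.FluidPDE.Config s d X)
    (i : Fin s) (x : X) (w : 𝔼) :
    maxwellianTensor β s (Function.update Zs i (x, w)) = Literature.Analysis.FunctionSpaces.maxwellianBeta β w *
      ∏ j ∈ Finset.univ \ {i}, Literature.Analysis.FunctionSpaces.maxwellianBeta β (Zs j).2 := by
  simp only [maxwellianTensor, Literature.Analysis.FluidPDE.tensorPow]
  have h1 : ∏ j, Literature.Analysis.FunctionSpaces.maxwellianBeta β ((Function.update Zs i (x, w)) j).2 =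
      ∏ j, Function.update (fun j => Literature.Analysis.FunctionSpaces.maxwellianBeta β (Zs j).2) i
        (Literature.Analysis.FunctionSpaces.maxwellianBeta β w) j := by
    refine Finset.prod_congr rfl fun j _ => ?_
    by_cases hj : j = i
    · subst hj; simp
    · simp [Function.update_of_ne hj]
  rw [h1, Finset.prod_update_of_mem (Finset.mem_univ i)]

/-- **Detailed balance in the collision configurations**: at `ε = 0`, the Maxwellian tensor takes
the value `M^{⊗s}(Z_s) M(v)` on the gain configuration of every collision term … [folklore] -/
theorem maxwellianTensor_gainConfig (G : Literature.Analysis.FluidPDE.Geometry d X) (β : ℝ) (Zs : Literature.Analysis.FluidPDE.Config s d X)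
    (i : Fin s) (ω : 𝕊) (v : 𝔼) :
    maxwellianTensor β (s + 1) (Literature.Analysis.FluidPDE.gainConfig G 0 Zs i ω v) =
      maxwellianTensor β s Zs * Literature.Analysis.FunctionSpaces.maxwellianBeta β v := by
  classical
  rw [Literature.Analysis.FluidPDE.gainConfig, maxwellianTensor_appendParticle, Literature.Analysis.FluidPDE.reflectVel_eq_collide,
    maxwellianTensor_update, maxwellianTensor_eq_mul_prod β Zs i]
  have hM := maxwellianBeta_collide_mul β ω (Zs i).2 v
  linear_combination (∏ j ∈ Finset.univ \ {i}, Literature.Analysis.FunctionSpaces.maxwellianBeta β (Zs j).2) * hM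

/-- … and on the loss configuration. [folklore] -/
theorem maxwellianTensor_lossConfig (G : Literature.Analysis.FluidPDE.Geometry d X) (β : ℝ) (Zs : Literature.Analysis.FluidPDE.Config s d X)
    (i : Fin s) (ω : 𝕊) (v : 𝔼) :
    maxwellianTensor β (s + 1) (Literature.Analysis.FluidPDE.lossConfig G 0 Zs i ω v) =
      maxwellianTensor β s Zs * Literature.Analysis.FunctionSpaces.maxwellianBeta β v := by
  rw [Literature.Analysis.FluidPDE.lossConfig, maxwellianTensor_appendParticle]

omit [Fintype d] in
/-- Particle `0` of an extended configuration is the old particle `0`. [folklore] -/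
theorem appendParticle_zero {k : ℕ} (Zs : Literature.Analysis.FluidPDE.Config (k + 1) d X) (x : X) (v : 𝔼) :
    Literature.Analysis.FluidPDE.appendParticle Zs x v 0 = Zs 0 :=
  Literature.Analysis.FluidPDE.appendParticle_castAdd Zs x v 0

/-- Particle `0` of the loss configuration. [folklore] -/
theorem lossConfig_apply_zero {k : ℕ} (G : Literature.Analysis.FluidPDE.Geometry d X) (Zs : Literature.Analysis.FluidPDE.Config (k + 1) d X)
    (i : Fin (k + 1)) (ω : 𝕊) (v : 𝔼) : Literature.Analysis.FluidPDE.lossConfig G 0 Zs i ω v 0 = Zs 0 := by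
  rw [Literature.Analysis.FluidPDE.lossConfig, appendParticle_zero]

/-- Particle `0` of the gain configuration of a background collision (`i ≠ 0`). [folklore] -/
theorem gainConfig_apply_zero_of_ne {k : ℕ} (G : Literature.Analysis.FluidPDE.Geometry d X)
    (Zs : Literature.Analysis.FluidPDE.Config (k + 1) d X) {i : Fin (k + 1)} (hi : i ≠ 0) (ω : 𝕊) (v : 𝔼) :
    Literature.Analysis.FluidPDE.gainConfig G 0 Zs i ω v 0 = Zs 0 := by
  rw [Literature.Analysis.FluidPDE.gainConfig, appendParticle_zero, Function.update_of_ne hi.symm]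

/-- Particle `0` of the gain configuration of a collision of the tagged particle (`i = 0`):
position `x₀`, velocity `v₀' = (collide ω (v₀, v)).1`. [folklore] -/
theorem gainConfig_apply_zero_zero {k : ℕ} (G : Literature.Analysis.FluidPDE.Geometry d X)
    (Zs : Literature.Analysis.FluidPDE.Config (k + 1) d X) (ω : 𝕊) (v : 𝔼) :
    Literature.Analysis.FluidPDE.gainConfig G 0 Zs 0 ω v 0 = ((Zs 0).1, (collide ω ((Zs 0).2, v)).1) := by
  rw [Literature.Analysis.FluidPDE.gainConfig, appendParticle_zero, Function.update_self, Literature.Analysis.FluidPDE.reflectVel_eq_collide]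

/-- The collision law only depends on the line spanned by the impact direction. [folklore] -/
theorem collide_neg (ω : 𝕊) (p : 𝔼 × 𝔼) : collide (-ω) p = collide ω p := by
  simp only [collide, coe_neg_sphere, inner_neg_right, neg_smul, smul_neg, neg_neg]

/-- BGSR's candidate solution of the tagged Boltzmann hierarchy (Remark 3.4):
`g^{(s)}(t, Z_s) = φ(t, z₀) M_β^{⊗s}(V_s)` for `s ≥ 1` (the tagged particle is particle `0`),
completed by the constant `1` at `s = 0` (no particle; it never enters the hierarchy for
`s ≥ 1`). [cite: BodineauGallagherSaintRaymondInvent2016, Remark 3.4] -/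
def bgsrHierarchyFamily (β : ℝ) (φ : ℝ → X → 𝔼 → ℝ) : (s : ℕ) → ℝ → Literature.Analysis.FluidPDE.Config s d X → ℝ
  | 0 => fun _ _ => 1
  | k + 1 => fun t Z => φ t (Z 0).1 (Z 0).2 * maxwellianTensor β (k + 1) Z

/-- Unfolding at `s = k + 1`. [folklore] -/
@[simp]
theorem bgsrHierarchyFamily_succ (β : ℝ) (φ : ℝ → X → 𝔼 → ℝ) (k : ℕ) (t : ℝ)
    (Z : Literature.Analysis.FluidPDE.Config (k + 1) d X) :
    bgsrHierarchyFamily β φ (k + 1) t Z = φ t (Z 0).1 (Z 0).2 * maxwellianTensor β (k + 1) Z := rfl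

/-- **Background collisions do not contribute** (BGSR Remark 3.4, the reason why the limiting
hierarchy closes on the linear Boltzmann equation): for `i ≠ 0` the `i`-th Boltzmann-hierarchy
collision term of `g^{(k+2)}` vanishes, since by detailed balance the gain and loss integrands
coincide up to the kernel, and `∫∫ (ω·(v - vᵢ)) C(v) dv dω = 0` by the antipodal symmetry of the
sphere. [cite: BodineauGallagherSaintRaymondInvent2016, Remark 3.4] -/
theorem hsCollisionTerm_bgsrHierarchyFamily_of_ne (G : Literature.Analysis.FluidPDE.Geometry d X) (β : ℝ)
    (φ : ℝ → X → 𝔼 → ℝ) {k : ℕ} {i : Fin (k + 1)} (hi : i ≠ 0) (τ : ℝ)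
    (W : Literature.Analysis.FluidPDE.Config (k + 1) d X) :
    Literature.Analysis.FluidPDE.hsCollisionTerm G 0 (k + 1) i (bgsrHierarchyFamily β φ (k + 2) τ) W = 0 := by
  unfold Literature.Analysis.FluidPDE.hsCollisionTerm
  set C : 𝔼 → ℝ := fun v => φ τ (W 0).1 (W 0).2 *
    (maxwellianTensor β (k + 1) W * Literature.Analysis.FunctionSpaces.maxwellianBeta β v) with hC
  have hint : ∀ (ω : 𝕊) (v : 𝔼),
      max ⟪(ω : 𝔼), v - (W i).2⟫_ℝ 0 *
          bgsrHierarchyFamily β φ (k + 2) τ (Literature.Analysis.FluidPDE.gainConfig G 0 W i ω v) -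
        max (-⟪(ω : 𝔼), v - (W i).2⟫_ℝ) 0 *
          bgsrHierarchyFamily β φ (k + 2) τ (Literature.Analysis.FluidPDE.lossConfig G 0 W i ω v) =
      ⟪(ω : 𝔼), v - (W i).2⟫_ℝ * C v := fun ω v => by
    rw [bgsrHierarchyFamily_succ, bgsrHierarchyFamily_succ, gainConfig_apply_zero_of_ne G W hi,
      lossConfig_apply_zero, maxwellianTensor_gainConfig, maxwellianTensor_lossConfig, ← sub_mul,
      max_zero_sub_max_neg_zero_eq_self]
  simp_rw [hint]
  set hh : 𝕊 → ℝ := fun ω => ∫ v, ⟪(ω : 𝔼), v - (W i).2⟫_ℝ * C v with hhh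
  have hodd : ∀ ω : 𝕊, hh (-ω) = -hh ω := fun ω => by
    simp only [hhh, coe_neg_sphere, inner_neg_left, neg_mul, integral_neg]
  have hsym := Literature.Analysis.FluidPDE.integral_comp_neg_sphere hh
  simp_rw [hodd, integral_neg] at hsym
  change ∫ ω, hh ω ∂sphereMeasure = 0
  linarith

/-- The Lorentz loss frequency is even: `∫ ((-u)·ω)₊ dω = ∫ (u·ω)₊ dω`. [folklore] -/
theorem TaggedBoltzmannHierarchy.lorentzLossRate_neg (u : 𝔼) : KineticTheory.lorentzLossRate (-u) = KineticTheory.lorentzLossRate u := by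
  unfold KineticTheory.lorentzLossRate
  rw [Literature.Analysis.FluidPDE.integral_posPart_inner_sphere_eq u]
  simp [inner_neg_left]

/-- The velocity integral behind the tagged collision term: for a bounded measurable `ψ`,
`∫_{S} ∫_{ℝ^d} [(ω·(v-v₀))₋ M(v) ψ(v₀') - (ω·(v-v₀))₊ M(v) ψ(v₀)] dv dω = K⁺ψ(v₀) - a(v₀) ψ(v₀)`
(Fubini, and evenness of the loss frequency). [folklore] -/
theorem integral_integral_tagged_eq {β : ℝ} (hβ : 0 < β) {ψ : 𝔼 → ℝ} (hψm : Measurable ψ) {C : ℝ}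
    (hψb : ∀ w, |ψ w| ≤ C) (v₀ : 𝔼) :
    ∫ ω : 𝕊, (∫ v : 𝔼, (gainIntegrand β ψ v₀ v ω -
        hardSphereKernel (v, v₀) ω * (Literature.Analysis.FunctionSpaces.maxwellianBeta β v * ψ v₀))) ∂sphereMeasure =
      linearBoltzmannGain β ψ v₀ - TaggedSphereDiffusion.collisionFrequency β v₀ * ψ v₀ := by
  have hM0 := fun w => (Literature.Analysis.FunctionSpaces.maxwellianBeta_pos (d := d) hβ w).le
  have hψv0 : |ψ v₀| ≤ C := hψb v₀
  have hsw : Measurable fun p : 𝕊 × 𝔼 => ((p.2, p.1) : 𝔼 × 𝕊) :=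
    measurable_snd.prodMk measurable_fst
  have hGm' := (measurable_gainIntegrand (β := β) hψm v₀).comp hsw
  have hGm : Measurable fun p : 𝕊 × 𝔼 => gainIntegrand β ψ v₀ p.2 p.1 := hGm'
  have hLc : Continuous fun p : 𝕊 × 𝔼 => hardSphereKernel (p.2, v₀) p.1 *
      (Literature.Analysis.FunctionSpaces.maxwellianBeta β p.2 * ψ v₀) :=
    (continuous_hardSphereKernel.comp ((continuous_snd.prodMk continuous_const).prodMk
      continuous_fst)).mul (((KineticTheory.continuous_maxwellianBeta β).comp continuous_snd).mul
      continuous_const)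
  have hLbound : ∀ (ω : 𝕊) (v : 𝔼), ‖hardSphereKernel (v, v₀) ω *
      (Literature.Analysis.FunctionSpaces.maxwellianBeta β v * ψ v₀)‖ ≤ (‖v₀‖ + ‖v‖) * Literature.Analysis.FunctionSpaces.maxwellianBeta β v * C :=
    fun ω v => by
      rw [Real.norm_eq_abs, abs_mul, abs_mul, abs_of_nonneg (hardSphereKernel_nonneg _ _),
        abs_of_nonneg (hM0 v)]
      calc hardSphereKernel (v, v₀) ω * (Literature.Analysis.FunctionSpaces.maxwellianBeta β v * |ψ v₀|)
          ≤ (‖v‖ + ‖v₀‖) * (Literature.Analysis.FunctionSpaces.maxwellianBeta β v * C) :=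
            mul_le_mul (hardSphereKernel_le v v₀ ω) (mul_le_mul_of_nonneg_left hψv0 (hM0 v))
              (mul_nonneg (hM0 v) (abs_nonneg _)) (add_nonneg (norm_nonneg _) (norm_nonneg _))
        _ = (‖v₀‖ + ‖v‖) * Literature.Analysis.FunctionSpaces.maxwellianBeta β v * C := by ring
  have hb := (integrable_norm_add_norm_mul_maxwellianBeta hβ v₀).mul_const C
  have hGi : ∀ ω : 𝕊, Integrable fun v => gainIntegrand β ψ v₀ v ω := fun ω =>
    hb.mono' ((measurable_gainIntegrand hψm v₀).comp
      (measurable_id.prodMk measurable_const)).aestronglyMeasurable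
      (Eventually.of_forall fun v => by
        rw [Real.norm_eq_abs]; exact abs_gainIntegrand_le hβ hψb v₀ v ω)
  have hLi : ∀ ω : 𝕊, Integrable fun v => hardSphereKernel (v, v₀) ω *
      (Literature.Analysis.FunctionSpaces.maxwellianBeta β v * ψ v₀) := fun ω =>
    hb.mono' (hLc.comp (Continuous.prodMk_right ω)).aestronglyMeasurable
      (Eventually.of_forall fun v => hLbound ω v)
  have hGprod : Integrable (Function.uncurry fun (ω : 𝕊) (v : 𝔼) => gainIntegrand β ψ v₀ v ω)
      ((sphereMeasure : Measure 𝕊).prod volume) :=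
    (hb.comp_snd (sphereMeasure : Measure 𝕊)).mono' hGm.aestronglyMeasurable
      (Eventually.of_forall fun p => by
        rw [Real.norm_eq_abs]; exact abs_gainIntegrand_le hβ hψb v₀ p.2 p.1)
  have hLprod : Integrable (Function.uncurry fun (ω : 𝕊) (v : 𝔼) => hardSphereKernel (v, v₀) ω *
      (Literature.Analysis.FunctionSpaces.maxwellianBeta β v * ψ v₀)) ((sphereMeasure : Measure 𝕊).prod volume) :=
    (hb.comp_snd (sphereMeasure : Measure 𝕊)).mono' hLc.aestronglyMeasurable
      (Eventually.of_forall fun p => hLbound p.1 p.2)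
  have h1 : ∀ ω : 𝕊, ∫ v, (gainIntegrand β ψ v₀ v ω - hardSphereKernel (v, v₀) ω *
      (Literature.Analysis.FunctionSpaces.maxwellianBeta β v * ψ v₀)) = (∫ v, gainIntegrand β ψ v₀ v ω) -
      ∫ v, hardSphereKernel (v, v₀) ω * (Literature.Analysis.FunctionSpaces.maxwellianBeta β v * ψ v₀) := fun ω =>
    integral_sub (hGi ω) (hLi ω)
  have hGo : Integrable (fun ω : 𝕊 => ∫ v, gainIntegrand β ψ v₀ v ω) sphereMeasure :=
    hGprod.integral_prod_left
  have hLo : Integrable (fun ω : 𝕊 => ∫ v, hardSphereKernel (v, v₀) ω *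
      (Literature.Analysis.FunctionSpaces.maxwellianBeta β v * ψ v₀)) sphereMeasure := hLprod.integral_prod_left
  simp_rw [h1]
  rw [integral_sub hGo hLo, integral_integral_swap hGprod, integral_integral_swap hLprod,
    linearBoltzmannGain_eq]
  congr 1
  simp_rw [integral_mul_const, ← mul_assoc]
  rw [integral_mul_const, collisionFrequency_eq]
  congr 1
  refine integral_congr_ae (Eventually.of_forall fun v => ?_)
  show (∫ ω, hardSphereKernel (v, v₀) ω ∂sphereMeasure) * Literature.Analysis.FunctionSpaces.maxwellianBeta β v =
    KineticTheory.lorentzLossRate (v₀ - v) * Literature.Analysis.FunctionSpaces.maxwellianBeta β v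
  rw [integral_hardSphereKernel, ← TaggedBoltzmannHierarchy.lorentzLossRate_neg, neg_sub]

/-- **The collision term of the tagged particle** (BGSR Remark 3.4): the `0`-th
Boltzmann-hierarchy collision term of `g^{(k+2)} = φ ⊗ M^{⊗(k+2)}` at `W` is
`M^{⊗(k+1)}(W) [K⁺_β φ(τ, x₀, ·)(v₀) - a_β(v₀) φ(τ, x₀, v₀)]`, `(x₀, v₀) = W 0` (detailed balance,
the antipodal symmetry to pass from the pre-collisional parametrisation `(ω·(v - v₀))_±` of
`Kinetic.hsCollisionTerm` to `((v₀ - v)·ω)₊`, and Fubini). [cite: BodineauGallagherSaintRaymondInvent2016, Remark 3.4] -/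
theorem hsCollisionTerm_bgsrHierarchyFamily_zero (G : Literature.Analysis.FluidPDE.Geometry d X) {β : ℝ} (hβ : 0 < β)
    (φ : ℝ → X → 𝔼 → ℝ) {k : ℕ} (τ : ℝ) (W : Literature.Analysis.FluidPDE.Config (k + 1) d X)
    (hφm : Measurable fun w => φ τ (W 0).1 w) {C : ℝ} (hφb : ∀ w, |φ τ (W 0).1 w| ≤ C) :
    Literature.Analysis.FluidPDE.hsCollisionTerm G 0 (k + 1) 0 (bgsrHierarchyFamily β φ (k + 2) τ) W =
      maxwellianTensor β (k + 1) W *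
        (linearBoltzmannGain β (fun w => φ τ (W 0).1 w) (W 0).2 -
          TaggedSphereDiffusion.collisionFrequency β (W 0).2 * φ τ (W 0).1 (W 0).2) := by
  rw [← integral_integral_tagged_eq hβ hφm hφb (W 0).2]
  unfold Literature.Analysis.FluidPDE.hsCollisionTerm
  -- pointwise form of the integrand
  have hint : ∀ (ω : 𝕊) (v : 𝔼),
      max ⟪(ω : 𝔼), v - (W 0).2⟫_ℝ 0 *
          bgsrHierarchyFamily β φ (k + 2) τ (Literature.Analysis.FluidPDE.gainConfig G 0 W 0 ω v) -
        max (-⟪(ω : 𝔼), v - (W 0).2⟫_ℝ) 0 *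
          bgsrHierarchyFamily β φ (k + 2) τ (Literature.Analysis.FluidPDE.lossConfig G 0 W 0 ω v) =
      maxwellianTensor β (k + 1) W *
        (max ⟪(ω : 𝔼), v - (W 0).2⟫_ℝ 0 * Literature.Analysis.FunctionSpaces.maxwellianBeta β v *
            φ τ (W 0).1 (collide ω ((W 0).2, v)).1 -
          max (-⟪(ω : 𝔼), v - (W 0).2⟫_ℝ) 0 * Literature.Analysis.FunctionSpaces.maxwellianBeta β v * φ τ (W 0).1 (W 0).2) :=
    fun ω v => by
      rw [bgsrHierarchyFamily_succ, bgsrHierarchyFamily_succ, gainConfig_apply_zero_zero,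
        lossConfig_apply_zero, maxwellianTensor_gainConfig, maxwellianTensor_lossConfig]
      ring
  have hint2 : ∀ ω : 𝕊, ∫ v, (max ⟪(ω : 𝔼), v - (W 0).2⟫_ℝ 0 *
          bgsrHierarchyFamily β φ (k + 2) τ (Literature.Analysis.FluidPDE.gainConfig G 0 W 0 ω v) -
        max (-⟪(ω : 𝔼), v - (W 0).2⟫_ℝ) 0 *
          bgsrHierarchyFamily β φ (k + 2) τ (Literature.Analysis.FluidPDE.lossConfig G 0 W 0 ω v)) =
      maxwellianTensor β (k + 1) W * ∫ v, (max ⟪(ω : 𝔼), v - (W 0).2⟫_ℝ 0 *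
          Literature.Analysis.FunctionSpaces.maxwellianBeta β v * φ τ (W 0).1 (collide ω ((W 0).2, v)).1 -
        max (-⟪(ω : 𝔼), v - (W 0).2⟫_ℝ) 0 * Literature.Analysis.FunctionSpaces.maxwellianBeta β v * φ τ (W 0).1 (W 0).2) :=
    fun ω => by rw [← integral_const_mul]; exact integral_congr_ae (Eventually.of_forall (hint ω))
  rw [integral_congr_ae (Eventually.of_forall hint2), integral_const_mul]
  congr 1
  -- antipodal change of variables in the outer integral
  rw [← Literature.Analysis.FluidPDE.integral_comp_neg_sphere]
  refine integral_congr_ae (Eventually.of_forall fun ω => ?_)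
  refine integral_congr_ae (Eventually.of_forall fun v => ?_)
  have e : -⟪(ω : 𝔼), v - (W 0).2⟫_ℝ = ⟪(W 0).2 - v, (ω : 𝔼)⟫_ℝ := by
    rw [real_inner_comm, ← inner_neg_left, neg_sub]
  simp only [coe_neg_sphere, inner_neg_left, collide_neg, gainIntegrand, hardSphereKernel, e]
  have e2 : -⟪(W 0).2 - v, (ω : 𝔼)⟫_ℝ = ⟪v - (W 0).2, (ω : 𝔼)⟫_ℝ := by
    rw [← inner_neg_left, neg_sub]
  rw [e2]
  ring

/-- Homogeneity of the hierarchy collision terms. [folklore] -/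
theorem hsCollisionTerm_const_mul (G : Literature.Analysis.FluidPDE.Geometry d X) (ε : ℝ) (s : ℕ) (i : Fin s) (c : ℝ)
    (g : Literature.Analysis.FluidPDE.Config (s + 1) d X → ℝ) (Zs : Literature.Analysis.FluidPDE.Config s d X) :
    Literature.Analysis.FluidPDE.hsCollisionTerm G ε s i (fun Z => c * g Z) Zs = c * Literature.Analysis.FluidPDE.hsCollisionTerm G ε s i g Zs := by
  unfold Literature.Analysis.FluidPDE.hsCollisionTerm
  rw [← integral_const_mul]
  refine integral_congr_ae (Eventually.of_forall fun ω => ?_)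
  simp only
  rw [← integral_const_mul]
  refine integral_congr_ae (Eventually.of_forall fun v => ?_)
  simp only
  ring

/-- Homogeneity of the Boltzmann hierarchy collision operator. [folklore] -/
theorem boltzmannHOp_const_mul (G : Literature.Analysis.FluidPDE.Geometry d X) (s : ℕ) (c : ℝ)
    (g : Literature.Analysis.FluidPDE.Config (s + 1) d X → ℝ) (Zs : Literature.Analysis.FluidPDE.Config s d X) :
    Literature.Analysis.FluidPDE.boltzmannHOp G s (fun Z => c * g Z) Zs = c * Literature.Analysis.FluidPDE.boltzmannHOp G s g Zs := by
  unfold Literature.Analysis.FluidPDE.boltzmannHOp Literature.Analysis.FluidPDE.boltzmannHierarchyOp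
  rw [Finset.mul_sum]
  exact Finset.sum_congr rfl fun i _ => hsCollisionTerm_const_mul G 0 s i c g Zs

/-- **The Boltzmann hierarchy collision operator on `g^{(k+2)} = φ ⊗ M^{⊗(k+2)}`** (BGSR
Remark 3.4): only the tagged particle contributes, and
`C⁰_{k+1,k+2} g^{(k+2)} (W) = M^{⊗(k+1)}(W) [K⁺_β φ(τ, x₀, ·)(v₀) - a_β(v₀) φ(τ, x₀, v₀)]`,
`(x₀, v₀) = W 0`, i.e. `M^{⊗(k+1)}(W) · (-L φ(τ, x₀, ·))(v₀)`.
[cite: BodineauGallagherSaintRaymondInvent2016, Remark 3.4] -/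
theorem boltzmannHOp_bgsrHierarchyFamily (G : Literature.Analysis.FluidPDE.Geometry d X) {β : ℝ} (hβ : 0 < β)
    (φ : ℝ → X → 𝔼 → ℝ) {k : ℕ} (τ : ℝ) (W : Literature.Analysis.FluidPDE.Config (k + 1) d X)
    (hφm : Measurable fun w => φ τ (W 0).1 w) {C : ℝ} (hφb : ∀ w, |φ τ (W 0).1 w| ≤ C) :
    Literature.Analysis.FluidPDE.boltzmannHOp G (k + 1) (bgsrHierarchyFamily β φ (k + 2) τ) W =
      maxwellianTensor β (k + 1) W *
        (linearBoltzmannGain β (fun w => φ τ (W 0).1 w) (W 0).2 -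
          TaggedSphereDiffusion.collisionFrequency β (W 0).2 * φ τ (W 0).1 (W 0).2) := by
  unfold Literature.Analysis.FluidPDE.boltzmannHOp Literature.Analysis.FluidPDE.boltzmannHierarchyOp
  rw [Fin.sum_univ_succ, hsCollisionTerm_bgsrHierarchyFamily_zero G hβ φ τ W hφm hφb]
  simp [hsCollisionTerm_bgsrHierarchyFamily_of_ne G β φ (Fin.succ_ne_zero _)]

end Hierarchy

section HierarchySolution

variable {X : Type*} [TopologicalSpace X] [LocallyCompactSpace X] [FirstCountableTopology X]
  {G : Literature.Analysis.FluidPDE.Geometry d X} {β α : ℝ}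

namespace LinearBoltzmannData

variable {f₀ : X → EuclideanSpace ℝ d → ℝ} {R : ℝ} (h : LinearBoltzmannData G β α f₀ R)
include h

/-- **BGSR Remark 3.4: `g_α^{(s)} = φ_α ⊗ M_β^{⊗s}` solves the tagged Boltzmann hierarchy with
rate `α`.** For every `s = k + 1 ≥ 1`, `t ≥ 0` and `Z_s`,
`g^{(s)}(t, Z_s) = (S_s(t) g^{(s)}(0))(Z_s) + α ∫₀ᵗ (S_s(t - τ) C⁰_{s,s+1} g^{(s+1)}(τ))(Z_s) dτ`
with free transport `S_s` (`Kinetic.freeTransport`) and the Boltzmann hierarchy collision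
operator `C⁰_{s,s+1}` (`Kinetic.boltzmannHOp`, GST (4.4.5)), where `φ_α` is the collision-series
solution of (1.3) ("is a solution to the Boltzmann hierarchy with initial data `g^{0(s)}` since
`φ_α` satisfies the linear Boltzmann equation (1.3) with initial data `ρ⁰`", BGSR p. 10).
[cite: BodineauGallagherSaintRaymondInvent2016, Remark 3.4 with (3.7)] -/
theorem bgsrHierarchyFamily_duhamel (k : ℕ) {t : ℝ} (ht : 0 ≤ t) (Z : Literature.Analysis.FluidPDE.Config (k + 1) d X) :
    bgsrHierarchyFamily β (linearBoltzmannSeries G β α f₀) (k + 1) t Z =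
      Literature.Analysis.FluidPDE.freeTransport G (k + 1) t
          (bgsrHierarchyFamily β (linearBoltzmannSeries G β α f₀) (k + 1) 0) Z +
        α * ∫ τ in (0 : ℝ)..t, Literature.Analysis.FluidPDE.freeTransport G (k + 1) (t - τ)
          (Literature.Analysis.FluidPDE.boltzmannHOp G (k + 1)
            (bgsrHierarchyFamily β (linearBoltzmannSeries G β α f₀) (k + 2) τ)) Z := by
  have hβ := h.beta_pos
  set x := G.translate (Z 0).1 (-t • (Z 0).2) with hx
  have e1 : ∀ τ, G.translate (Z 0).1 (-(t - τ) • (Z 0).2) = G.translate x (τ • (Z 0).2) := fun τ => by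
    rw [hx, translate_translate_smul]
    congr 1
    rw [show -t + τ = -(t - τ) by ring]
  have e2 : (Z 0).1 = G.translate x (t • (Z 0).2) := by
    rw [hx, translate_translate_smul, neg_add_cancel, zero_smul, G.translate_zero]
  -- the collision operator along the backward free flight
  have hC : ∀ τ, Literature.Analysis.FluidPDE.boltzmannHOp G (k + 1)
      (bgsrHierarchyFamily β (linearBoltzmannSeries G β α f₀) (k + 2) τ)
      (Literature.Analysis.FluidPDE.freeFlight G (-(t - τ)) Z) =
      maxwellianTensor β (k + 1) Z *
        (linearBoltzmannGain β (fun w => linearBoltzmannSeries G β α f₀ τ (G.translate x (τ • (Z 0).2)) w) (Z 0).2 -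
          TaggedSphereDiffusion.collisionFrequency β (Z 0).2 * linearBoltzmannSeries G β α f₀ τ (G.translate x (τ • (Z 0).2)) (Z 0).2) :=
    fun τ => by
      rw [boltzmannHOp_bgsrHierarchyFamily G hβ _ τ _ (h.measurable_linearBoltzmannSeries τ _)
        (fun w => h.abs_linearBoltzmannSeries_le τ _ w)]
      simp only [Literature.Analysis.FluidPDE.freeFlight_apply, maxwellianTensor_freeFlight, e1]
  simp only [Literature.Analysis.FluidPDE.freeTransport_apply, bgsrHierarchyFamily_succ, Literature.Analysis.FluidPDE.freeFlight_apply,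
    maxwellianTensor_freeFlight]
  simp_rw [hC]
  rw [intervalIntegral.integral_const_mul, linearBoltzmannSeries_zero]
  have key := h.linearBoltzmannSeries_duhamel ht x (Z 0).2
  have hI : ∫ τ in (0 : ℝ)..t, (α * linearBoltzmannGain β
        (fun w => linearBoltzmannSeries G β α f₀ τ (G.translate x (τ • (Z 0).2)) w) (Z 0).2 -
      α * TaggedSphereDiffusion.collisionFrequency β (Z 0).2 * linearBoltzmannSeries G β α f₀ τ (G.translate x (τ • (Z 0).2)) (Z 0).2) =
      α * ∫ τ in (0 : ℝ)..t, (linearBoltzmannGain β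
        (fun w => linearBoltzmannSeries G β α f₀ τ (G.translate x (τ • (Z 0).2)) w) (Z 0).2 -
      TaggedSphereDiffusion.collisionFrequency β (Z 0).2 * linearBoltzmannSeries G β α f₀ τ (G.translate x (τ • (Z 0).2)) (Z 0).2) := by
    rw [← intervalIntegral.integral_const_mul]
    exact intervalIntegral.integral_congr fun τ _ => by ring
  rw [hI] at key
  conv_lhs => rw [e2]
  rw [key, ← hx]
  ring

/-- **The rescaled family `(α^s g_α^{(s)})_s` is a mild solution of the Boltzmann hierarchy** in
the accepted (rate-free) sense `Kinetic.IsMildBoltzmannHierarchySolutionOn` (GST (4.4.5)–(4.4.7)):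
the factor `α` of BGSR's hierarchy (3.7) is absorbed by `g^{(s)} ↦ α^s g^{(s)}`, both operators
being linear; the empty level `s = 0` carries the constant `1`.
[cite: BodineauGallagherSaintRaymondInvent2016, Remark 3.4 with (3.7)–(3.8)] -/
theorem isMildBoltzmannHierarchySolutionOn (T : ℝ) :
    Literature.Analysis.FluidPDE.IsMildBoltzmannHierarchySolutionOn T G
      (fun s t Z => α ^ s * bgsrHierarchyFamily β (linearBoltzmannSeries G β α f₀) s t Z) := by
  intro s t ht Z
  cases s with
  | zero =>
    simp [bgsrHierarchyFamily, Literature.Analysis.FluidPDE.freeTransport_apply, Literature.Analysis.FluidPDE.boltzmannHOp]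
  | succ k =>
    have main := h.bgsrHierarchyFamily_duhamel k ht.1 Z
    have hhom : ∀ (τ : ℝ) (W : Literature.Analysis.FluidPDE.Config (k + 1) d X), Literature.Analysis.FluidPDE.boltzmannHOp G (k + 1)
        ((fun s t Z => α ^ s * bgsrHierarchyFamily β (linearBoltzmannSeries G β α f₀) s t Z)
          (k + 1 + 1) τ) W =
        α ^ (k + 2) * Literature.Analysis.FluidPDE.boltzmannHOp G (k + 1)
          (bgsrHierarchyFamily β (linearBoltzmannSeries G β α f₀) (k + 2) τ) W :=
      fun τ W => boltzmannHOp_const_mul G (k + 1) (α ^ (k + 2)) _ W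
    simp only [Literature.Analysis.FluidPDE.freeTransport_apply] at main ⊢
    simp_rw [hhom]
    rw [main, mul_add, ← intervalIntegral.integral_const_mul, ← intervalIntegral.integral_const_mul]
    congr 1
    refine intervalIntegral.integral_congr fun τ _ => ?_
    ring

end LinearBoltzmannData

end HierarchySolution

/-! ### On the torus -/

section Torus

local notation "𝕋" => UnitAddTorus d

/-- **BGSR Remark 3.4 in the paper's setting**: on `T^d`, for `β > 0`, `α ≥ 0` and a continuous
datum `0 ≤ ρ⁰ ≤ R`, the rescaled family `(α^s φ_α ⊗ M_β^{⊗s})_s` built on the solution `φ_α` of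
(1.3) with datum `ρ⁰` is a mild solution of the Boltzmann hierarchy on every `[0, T]`.
[cite: BodineauGallagherSaintRaymondInvent2016, Remark 3.4] -/
theorem isMildBoltzmannHierarchySolutionOn_torus {β α : ℝ} (hβ : 0 < β) (hα : 0 ≤ α)
    {ρ₀ : 𝕋 → ℝ} (hρ₀ : Continuous ρ₀) (hρ₀0 : ∀ x, 0 ≤ ρ₀ x) {R : ℝ} (hR : ∀ x, ρ₀ x ≤ R)
    (T : ℝ) :
    Literature.Analysis.FluidPDE.IsMildBoltzmannHierarchySolutionOn T (Literature.Analysis.FluidPDE.Torus.geometry d)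
      (fun s t Z => α ^ s * bgsrHierarchyFamily β
        (linearBoltzmannSeries (Literature.Analysis.FluidPDE.Torus.geometry d) β α fun x _ => ρ₀ x) s t Z) :=
  (linearBoltzmannData_torus hβ hα hρ₀ hρ₀0 hR).isMildBoltzmannHierarchySolutionOn T

end Torus

end Hilbert6

end

end Literature.MathematicalPhysics.KineticTheory
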